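import Literature.MathematicalPhysics.QuantumFieldTheory.Balaban1983to89.B8Prop3KLevel

/-!
# `Balaban1983to89.B8Prop3KLevelBdry` — [Balaban1985RegularSpaces] PROPOSITION 3 (p. 87) «(1.40)–(1.42) + (1.61) ⇒ (1.62)» AT `k`
# LEVELS, THE (1.59) INPUTS CARRYING ADDITIVE BOUNDARY ALLOWANCES — the bootstrap algebra of pp. 86–87 for a FINITE `Ω₀`

statement-level skeleton of published theorems with citation tags; proofs where landed; nothing here is a claim about the
Yang–Mills mass gap

T. Bałaban, *Spaces of regular gauge field configurations on a lattice and gauge fixing conditions*, Commun. Math. Phys. **99**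
(1985) 75–102 `[Balaban1985RegularSpaces]` ("B8"), (1.55)–(1.62) pp. 86–87, Proposition 3 p. 87.  PDF held:
`paper:balaban1985-cmp99-regular-spaces-gauge-fixing` (journal page = PDF page + 74).

CITATION HEADER (lean-in-tree rule).  Cell `pub-ymgap` (YM Track A, HUMAN RULING D-0062), DAG node N05 = [B8], seat `pub-ymgap-dag-n05-e`
(R141 (C) fan-out), generation g6 — first brick of the LOCATED REPAIR (R-d) of the (1.59) socket currency (this seat's g5 certificates
`B8SockH59CornerDefect` ∕ `B8SockH59NotAtCube` ∕ `B8JunctionH59Vacuity`, desk note `CORNER-DEFECT-H59.md`).  WHY: the tree's (1.59) socket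
(`B8LeafModelZd.SockH59`, and the `h59a`∕`h59g` lines of n05-b's `B8Prop3KLevel.prop3_norms_kLevel` it feeds) bounds the weighted supremum
of `A′` over the SIDES OF THE PLAQUETTES TOUCHING `Ω_j` by `B₀(|J|₍₋₃₎ + |B₁|)`, a right-hand side blind to the collar of bonds with both
end-points outside `Ω₀`; at a finite `Ω₀` the exterior data on that collar are free, and the socket is false (kernel witnesses).  Print
((1.58): `A = G(U₀)J + …`, `G(U₀)` the propagator of [4] for the region) presupposes the exterior data inside `J` ∕ the boundary
condition; the located repair R-d adds them EXPLICITLY: the (1.59) lines carry an additive boundary allowance `β` (at the consumer: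
`β = B_∂ · sup_{outer collar} η|A′| ≤ 2B_∂α₁` from (1.66)₀ and the support of the gauge transformation).  THIS MODULE is print's bootstrap
(1.55) + (1.56) + (1.59) ⇒ (1.60) ⇒ (1.62) WITH SUCH ALLOWANCES — pure real algebra on top of n05-b's assembly; it is consumed by the
repaired Proposition-3 socket `B8Prop3GaugeFixedKLevelBdry` (sequel).  Kind «kernel-checked proof», theorems only, no `def`.

WHAT IS PRINTED (p. 86 [PDF 12], verbatim, text layer): *"Theorem 3.3 of [4] implies the bounds: |A|₍₋₁₎, |∇^η_{U₀}A|₍₋₂₎, … ≦ B₀(… +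
2dLα₁ + C₂α₂²). (1.59)  Let us take this bound for |∇^η_{U₀}A|₍₋₂₎ on the left-hand side, and let us assume that B₀36dα₂ ≦ 1/2. This gives
us a bound for |∇^η_{U₀}A|₍₋₂₎, equal to the right-hand side above without this term and multiplied by 2."*; p. 87: *"Now we assume further
that 2α₂² + 20dα₀α₂ + 2C₂α₂² ≦ α₀ + α₁. (1.61) … Proposition 3. If U₀, U₁U₀ satisfy (1.40)–(1.42) … then U₁ satisfies (1.36)–(1.39) with
B₁ = 5dLB₀"*.

WHAT THIS MODULE PROVES (kernel, 0 sorry).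
§1 `apriori_160_bdry` — `B8.apriori_160` with the four (1.59) lines `x ≤ B₀(nJ + nB) + β_x`: the bootstrap gives
   `g ≤ 2B₀Y + 2β_g` and `x ≤ 2B₀Y + β_x + β_g` for `x ∈ {a, j₂, l}`, `2B₀Y ≤` the printed (1.60) number.
§2 **`prop3_norms_kLevel_bdry`** — n05-b's `B8Prop3KLevel.prop3_norms_kLevel` (same data, hypotheses, windows) with the (1.59) inputs
   `h59a`∕`h59g`∕`h59j`∕`h59l` each carrying an additive allowance `βa`∕`βg`∕`βj`∕`βl ≥ 0`; conclusion (1.62) in norm form with the allowances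
   displayed: `a ≤ 5dLB₀(α₀ + α₁) + βa + βg`, `g ≤ 5dLB₀(α₀ + α₁) + 2βg`, `j₂ ≤ … + βj + βg`, `l ≤ … + βl + βg`.
§3 `prop3_norms_kLevel_bdry_absorbed` — the SAME CONSTANT `5dLB₀(α₀ + α₁)` for the first two members when the allowances fit the slack of
   (1.60) ⇒ (1.62): `βa + βg ≤ (dL − 1)B₀(α₀ + α₁)` and `2βg ≤ (dL − 1)B₀(α₀ + α₁)` (the printed estimate `B₀(4α₀ + 4dLα₁ + [≤ α₀ + α₁])
   ≤ 5dLB₀(α₀ + α₁)` has exactly that slack; `dL ≥ 1`).  So the Theorem-4 induction's invariant `c⋆ = 5dLB₀(α₀ + α₁)` is UNCHANGED by the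
   repair whenever `4B_∂α₁ ≤ (dL − 1)B₀(α₀ + α₁)`, e.g. under the constant side condition `4B_∂ ≤ (dL − 1)B₀`.

HONEST SCOPE.  (i) Real algebra + n05-b's assembly by name ((1.55) `B8Eq155KLevelLocal`, (1.56) `B8Eq156KLevelLocal`); nothing of [4] Theorem
3.3 or of the boundary estimate is proved — the allowances are HYPOTHESES' slack, their provider is the repaired socket.  (ii) Located readings of
`B8Prop3KLevel` apply verbatim ((1.41) and the gradient datum on `SideTouches (Ω j)`, `hbox`, windows, `d ≥ 2`, `ℤᵈ` carriers, `≤` for `<`).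
(iii) R-d is the TREE's bookkeeping of exterior data at a finite `Ω₀`; print's Proposition 6 applies Theorem 4 at the finite cube family
`{□_j}` with exterior data `U₀′` on `□̃ ∖ □₀` ((1.131)–(1.133) p. 99), so some such bookkeeping is needed by any faithful typing; the constant
`B_∂` is not a printed constant.  Count-neutral; N05 NOT discharged; one finite `𝕋⁴` programme at fixed `ε`, Bałaban as printed; nothing
continuum ∕ ℝ⁴ ∕ OS ∕ mass-gap ∕ Clay.  Unit `pub-ymgap-dag-n05-e` (g6), 2026-08-27.
-/

noncomputable section

open scoped BigOperators
open NormedSpace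

namespace Literature.MathematicalPhysics.QuantumFieldTheory.Balaban1983to89.B8Prop3KLevelBdry

open B7Prop1Explicit (U1)
open B7Prop1Local (InBox loK bondHiK)
open B7Prop2Explicit (C0 c2' unitaryUnits unitaryUnits_le_U1 avgClosed_unitaryUnits)
open B7Prop3Flat (c3)
open B7Prop4GeneralLevels (logCovIter linCovIter)
open B8Lemma1NonAbelian (mulCfg)
open B8Ineq132 (covDerivFwd InAk BondTouches)
open B8Eq146AExpansion (iEta expCfg)
open B8Eq155JBound (Jcur wsup)
open B8Eq140Level (SideTouches)
open B8ScaledSupNorm (bondNorm msup weight Bdd)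
open B8Eq155KLevelLocal (eq155_norm_kLevel_hermitian)
open B8Eq156KLevelLocal (wsup_B1_le_kLevel)
open B8Prop3KLevel (bound_of_sideTouches)

-- `Site` alone would resolve to the torus sites of `Setup.lean`; re-export the `ℤ^d` sites of `B7Prop1Explicit`.
export B7Prop1Explicit (Site)

variable {d : ℕ} {𝔸 : Type*} [CStarAlgebra 𝔸] [Nontrivial 𝔸]

/-! ## §1 The bootstrap (1.55) + (1.56) + (1.59) ⇒ (1.60) with boundary allowances -/

/-- **`B8.apriori_160` WITH ADDITIVE ALLOWANCES ON THE (1.59) LINES**: from (1.55) `nJ ≤ 2α₀ + 36dα₂·g + 50dα₂³ + 10dα₀α₂`, (1.56)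
`nB ≤ 2dLα₁ + C₂α₂²`, the four lines `x ≤ B₀(nJ + nB) + β_x` (`x = a, g, j₂, l`), «B₀36dα₂ ≦ 1/2» and `50dα₂ ≤ 1`: with
`P := B₀(4α₀ + 4dLα₁ + 2α₂² + 20dα₀α₂ + 2C₂α₂²)` (the printed (1.60) number), `g ≤ P + 2β_g` and `x ≤ P + β_x + β_g` for `x = a, j₂, l`
(the gradient line is the one that bootstraps, p. 86). Pure real algebra. [cite: Balaban1985RegularSpaces, (1.55)–(1.60) pp.86–87] -/
theorem apriori_160_bdry {d L C₂ B₀ α₀ α₁ α₂ nJ nB a g j₂ l βa βg βj βl : ℝ}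
    (hd : 0 ≤ d) (hB₀ : 0 ≤ B₀) (hα₂ : 0 ≤ α₂) (hg : 0 ≤ g)
    (h55 : nJ ≤ 2 * α₀ + 36 * d * α₂ * g + 50 * d * α₂ ^ 3 + 10 * d * α₀ * α₂)
    (h56 : nB ≤ 2 * d * L * α₁ + C₂ * α₂ ^ 2)
    (h59a : a ≤ B₀ * (nJ + nB) + βa) (h59g : g ≤ B₀ * (nJ + nB) + βg) (h59j : j₂ ≤ B₀ * (nJ + nB) + βj)
    (h59l : l ≤ B₀ * (nJ + nB) + βl)
    (hside : 36 * d * B₀ * α₂ ≤ 1 / 2) (h50 : 50 * d * α₂ ≤ 1) :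
    a ≤ B₀ * (4 * α₀ + 4 * d * L * α₁ + 2 * α₂ ^ 2 + 20 * d * α₀ * α₂ + 2 * C₂ * α₂ ^ 2) + βa + βg ∧
    g ≤ B₀ * (4 * α₀ + 4 * d * L * α₁ + 2 * α₂ ^ 2 + 20 * d * α₀ * α₂ + 2 * C₂ * α₂ ^ 2) + 2 * βg ∧
    j₂ ≤ B₀ * (4 * α₀ + 4 * d * L * α₁ + 2 * α₂ ^ 2 + 20 * d * α₀ * α₂ + 2 * C₂ * α₂ ^ 2) + βj + βg ∧
    l ≤ B₀ * (4 * α₀ + 4 * d * L * α₁ + 2 * α₂ ^ 2 + 20 * d * α₀ * α₂ + 2 * C₂ * α₂ ^ 2) + βl + βg := by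
  set Y := 2 * α₀ + 50 * d * α₂ ^ 3 + 10 * d * α₀ * α₂ + nB with hY
  -- (1.59) combined with (1.55): every norm is ≤ B₀Y + (36dB₀α₂)·g + its allowance
  have hJB : nJ + nB ≤ Y + 36 * d * α₂ * g := by rw [hY]; linarith
  have hstep : B₀ * (nJ + nB) ≤ B₀ * Y + 36 * d * B₀ * α₂ * g := by
    have := mul_le_mul_of_nonneg_left hJB hB₀
    linarith [this]
  have hθg : 36 * d * B₀ * α₂ * g ≤ (1 / 2) * g := by
    have := mul_le_mul_of_nonneg_right hside hg
    linarith [this]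
  -- bootstrap for g = |∇A|₍₋₂₎ («B₀36dα₂ ≦ 1/2»)
  have hg2 : g ≤ 2 * (B₀ * Y) + 2 * βg := by linarith
  have hall : ∀ x β, x ≤ B₀ * (nJ + nB) + β → x ≤ 2 * (B₀ * Y) + β + βg := fun x β hx => by linarith
  -- 2B₀Y ≤ the printed (1.60) bound, using (1.56) and 100dα₂³ ≤ 2α₂² (⇐ 50dα₂ ≤ 1)
  have hdα : 0 ≤ d * α₂ := mul_nonneg hd hα₂
  have hcube : 100 * d * α₂ ^ 3 ≤ 2 * α₂ ^ 2 := by nlinarith [sq_nonneg α₂, hdα]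
  have hfin : 2 * (B₀ * Y) ≤
      B₀ * (4 * α₀ + 4 * d * L * α₁ + 2 * α₂ ^ 2 + 20 * d * α₀ * α₂ + 2 * C₂ * α₂ ^ 2) := by
    have hin : 2 * Y ≤ 4 * α₀ + 4 * d * L * α₁ + 2 * α₂ ^ 2 + 20 * d * α₀ * α₂ + 2 * C₂ * α₂ ^ 2 := by
      rw [hY]; linarith
    have := mul_le_mul_of_nonneg_left hin hB₀
    linarith [this]
  refine ⟨?_, ?_, ?_, ?_⟩
  · linarith [hall a βa h59a]
  · linarith [hg2]
  · linarith [hall j₂ βj h59j]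
  · linarith [hall l βl h59l]

/-- **THE SLACK OF (1.60) ⇒ (1.62)**: under (1.61) and `dL ≥ 1`, the printed number `B₀(4α₀ + 4dLα₁ + 2α₂² + 20dα₀α₂ + 2C₂α₂²)` plus any
allowance `β ≤ (dL − 1)B₀(α₀ + α₁)` is still `≤ 5dLB₀(α₀ + α₁)` — `B8.apriori_162` sharpened by its own slack
`B₀((5dL − 5)α₀ + (dL − 1)α₁) ≥ (dL − 1)B₀(α₀ + α₁)`. Pure real algebra. [cite: Balaban1985RegularSpaces, (1.60)–(1.62) p.87] -/
theorem apriori_162_bdry {d L C₂ B₀ α₀ α₁ α₂ β : ℝ} (hB₀ : 0 ≤ B₀) (hdL : 1 ≤ d * L) (hα₀ : 0 ≤ α₀)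
    (h61 : 2 * α₂ ^ 2 + 20 * d * α₀ * α₂ + 2 * C₂ * α₂ ^ 2 ≤ α₀ + α₁) (hβ : β ≤ (d * L - 1) * B₀ * (α₀ + α₁)) :
    B₀ * (4 * α₀ + 4 * d * L * α₁ + 2 * α₂ ^ 2 + 20 * d * α₀ * α₂ + 2 * C₂ * α₂ ^ 2) + β ≤
      5 * d * L * B₀ * (α₀ + α₁) := by
  have h : B₀ * (4 * α₀ + 4 * d * L * α₁ + 2 * α₂ ^ 2 + 20 * d * α₀ * α₂ + 2 * C₂ * α₂ ^ 2) ≤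
      B₀ * (5 * α₀ + (4 * d * L + 1) * α₁) := by
    apply mul_le_mul_of_nonneg_left _ hB₀
    linarith
  have hslack : B₀ * (5 * α₀ + (4 * d * L + 1) * α₁) + (d * L - 1) * B₀ * (α₀ + α₁) ≤ 5 * d * L * B₀ * (α₀ + α₁) := by
    have h1 : 0 ≤ (d * L - 1) * B₀ * α₀ := mul_nonneg (mul_nonneg (sub_nonneg.2 hdL) hB₀) hα₀
    nlinarith [h1]
  linarith [h, hslack, hβ]

/-! ## §2 (1.62) in norm form at `k` levels, the (1.59) inputs with boundary allowances -/

/-- **(1.40)–(1.42) + (1.61) ⇒ (1.62), NORM FORM, AT `k` LEVELS, THE (1.59) INPUTS CARRYING ADDITIVE BOUNDARY ALLOWANCES** — n05-b's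
`B8Prop3KLevel.prop3_norms_kLevel` VERBATIM (data `U₀` unitary, `A` Hermitian; (1.40) `h40₀`∕`h40₁`; (1.41) on `SideTouches (Ω j)`; the gradient
datum `g`; (1.42) on `Λ_j`; the windows; (1.61) with `C₂ ≥ C₂(d, α₀)`) except that the four (1.59) lines read `x ≤ B₀(|J|₍₋₃₎ + |B₁|) + β_x`
(`x = a, g, j₂, l`; the allowances are arbitrary reals — at the consumer, the exterior-collar term of a finite `Ω₀`).  Conclusion: (1.62) with
`B₁ = 5dLB₀` and the allowances displayed — `a ≤ 5dLB₀(α₀ + α₁) + βa + βg`, `g ≤ 5dLB₀(α₀ + α₁) + 2βg`, `j₂ ≤ … + βj + βg`, `l ≤ … + βl + βg`.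
[cite: Balaban1985RegularSpaces, Prop. 3 (1.62) p.87; (1.55)–(1.61) p.86] -/
theorem prop3_norms_kLevel_bdry (hd2 : 2 ≤ d) {η : ℝ} (hη : 0 < η) {L : ℕ} (hL : 2 ≤ L) {k : ℕ}
    {U₀ : Site d → Fin d → 𝔸ˣ} (hU₀ : ∀ y κ, U₀ y κ ∈ unitaryUnits 𝔸)
    {A : Site d → Fin d → 𝔸} (hAh : ∀ y κ, IsSelfAdjoint (A y κ)) {α₀ α₁ α₂ g : ℝ}
    (hα₀ : 0 < α₀) (hα₁ : 0 ≤ α₁) (hα₂ : 0 ≤ α₂) (hg0 : 0 ≤ g)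
    (hα3 : C0 d * α₀ ≤ 1 / 3) (hα4 : 4 * α₀ ≤ c2' d L) (h16 : 16 * α₂ ≤ 1) (hd5 : 5 * α₂ * ((d : ℝ) - 1) ≤ 4)
    (hsmall : Real.exp (4 * (800 * ((d : ℝ) + 1) ^ 2 * ((d : ℝ) + 4)) * α₀)
      * (1 + 8 * (131072 * ((d : ℝ) + 1) ^ 2) * α₂) ≤ 2)
    (hc₃ : 2 * α₂ ≤ c3 d L) {B₀ : ℝ} (hB₀ : 0 ≤ B₀) (hside : 36 * d * B₀ * α₂ ≤ 1 / 2) (h50 : 50 * d * α₂ ≤ 1)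
    {C₂ : ℝ} (hC₂ : 8 * (131072 * ((d : ℝ) + 1) ^ 2) * Real.exp (4 * (800 * ((d : ℝ) + 1) ^ 2 * ((d : ℝ) + 4)) * α₀) ≤ C₂)
    (h61 : 2 * α₂ ^ 2 + 20 * d * α₀ * α₂ + 2 * C₂ * α₂ ^ 2 ≤ α₀ + α₁)
    {Ω : ℕ → Set (Site d)} {Λ : ℕ → Set (Site d × Fin d)}
    (hbox : ∀ j, j ≤ k → ∀ c ∈ Λ j, ∀ x, InBox (loK L j c.1) (bondHiK L j c.1 c.2) x → x ∈ Ω j)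
    (h40₀ : InAk L k η α₀ Ω U₀) (h40₁ : InAk L k η α₀ Ω (mulCfg (expCfg (iEta η A)) U₀))
    (h41 : ∀ j, j ≤ k → ∀ y τ, SideTouches (Ω j) y τ → ‖A y τ‖ ≤ α₂ * ((L : ℝ) ^ j * η)⁻¹)
    (hg : ∀ j, j ≤ k → ∀ (y : Site d) (κ τ : Fin d), SideTouches (Ω j) y τ →
      ((L : ℝ) ^ j * η) ^ 2 * ‖covDerivFwd η U₀ κ (fun z => A z τ) y‖ ≤ g)
    (h42 : ∀ j, j ≤ k → ∀ c ∈ Λ j, ‖logCovIter L U₀ (iEta η A) j c.1 c.2‖ < 2 * d * L * α₁)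
    {a j₂ l βa βg βj βl : ℝ}
    (h59a : a ≤ B₀ * (bondNorm L k η (-(3 : ℝ)) Ω (fun x μ => Jcur η U₀ A μ x)
      + wsup 1 (fun p : {p : ℕ × (Site d × Fin d) // p.1 ≤ k ∧ p.2 ∈ Λ p.1} =>
          linCovIter L U₀ (iEta η A) p.1.1 p.1.2.1 p.1.2.2)) + βa)
    (h59g : g ≤ B₀ * (bondNorm L k η (-(3 : ℝ)) Ω (fun x μ => Jcur η U₀ A μ x)
      + wsup 1 (fun p : {p : ℕ × (Site d × Fin d) // p.1 ≤ k ∧ p.2 ∈ Λ p.1} =>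
          linCovIter L U₀ (iEta η A) p.1.1 p.1.2.1 p.1.2.2)) + βg)
    (h59j : j₂ ≤ B₀ * (bondNorm L k η (-(3 : ℝ)) Ω (fun x μ => Jcur η U₀ A μ x)
      + wsup 1 (fun p : {p : ℕ × (Site d × Fin d) // p.1 ≤ k ∧ p.2 ∈ Λ p.1} =>
          linCovIter L U₀ (iEta η A) p.1.1 p.1.2.1 p.1.2.2)) + βj)
    (h59l : l ≤ B₀ * (bondNorm L k η (-(3 : ℝ)) Ω (fun x μ => Jcur η U₀ A μ x)
      + wsup 1 (fun p : {p : ℕ × (Site d × Fin d) // p.1 ≤ k ∧ p.2 ∈ Λ p.1} =>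
          linCovIter L U₀ (iEta η A) p.1.1 p.1.2.1 p.1.2.2)) + βl) :
    a ≤ 5 * d * L * B₀ * (α₀ + α₁) + βa + βg ∧ g ≤ 5 * d * L * B₀ * (α₀ + α₁) + 2 * βg ∧
    j₂ ≤ 5 * d * L * B₀ * (α₀ + α₁) + βj + βg ∧ l ≤ 5 * d * L * B₀ * (α₀ + α₁) + βl + βg := by
  have hL1 : 1 ≤ L := le_trans (by norm_num) hL
  have h₀ : ∀ y κ, U₀ y κ ∈ U1 𝔸 := fun y κ => unitaryUnits_le_U1 (hU₀ y κ)
  -- (1.55) at `k` levels (`B8Eq155KLevelLocal`)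
  have h55 := eq155_norm_kLevel_hermitian hη hL1 h₀ hAh hα₀.le hα₂ h16 hd5 hg0 h40₀ h40₁ h41 hg
  -- (1.56) at `k` levels (`B8Eq156KLevelLocal`), with (1.41) moved to the bonds touching `Ω_j`
  have h41' : ∀ j, j ≤ k → ∀ x μ, BondTouches (Ω j) x μ → ‖A x μ‖ ≤ α₂ * ((L : ℝ) ^ j * η)⁻¹ :=
    fun j hj x μ hb => bound_of_sideTouches hd2 (h41 j hj) x μ hb
  have h56 := wsup_B1_le_kLevel hη L hL (avgClosed_unitaryUnits d L) U₀ hU₀ hα₀ hα3 hα4 A hα₂ hsmall hc₃ hbox h40₀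
    h41' hα₁ h42
  -- the bootstrap (1.55) + (1.56) + (1.59)+β ⇒ (1.60)+β, with `C₂(d, α₀)`
  obtain ⟨ha, hg', hj, hl⟩ := apriori_160_bdry (Nat.cast_nonneg d) hB₀ hα₂ hg0 h55 h56 h59a h59g h59j h59l hside h50
  -- `C₂(d, α₀) ≤ C₂`, so (1.60) holds with `C₂`
  set R₀ := B₀ * (4 * α₀ + 4 * d * L * α₁ + 2 * α₂ ^ 2 + 20 * d * α₀ * α₂
      + 2 * (8 * (131072 * ((d : ℝ) + 1) ^ 2) * Real.exp (4 * (800 * ((d : ℝ) + 1) ^ 2 * ((d : ℝ) + 4)) * α₀))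
        * α₂ ^ 2) with hR₀
  set R₁ := B₀ * (4 * α₀ + 4 * d * L * α₁ + 2 * α₂ ^ 2 + 20 * d * α₀ * α₂ + 2 * C₂ * α₂ ^ 2) with hR₁
  have hR : R₀ ≤ R₁ := by
    rw [hR₀, hR₁]
    apply mul_le_mul_of_nonneg_left _ hB₀
    have hsq : 0 ≤ α₂ ^ 2 := sq_nonneg _
    nlinarith [mul_le_mul_of_nonneg_right hC₂ hsq]
  -- (1.60) + (1.61) ⇒ (1.62) (`B8.apriori_162`)
  have hd' : (1 : ℝ) ≤ d := by exact_mod_cast (le_trans (by norm_num) hd2)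
  have hdL : (1 : ℝ) ≤ (d : ℝ) * L := by
    have hL' : (1 : ℝ) ≤ L := by exact_mod_cast hL1
    nlinarith
  have h162 : R₁ ≤ 5 * d * L * B₀ * (α₀ + α₁) := by
    rw [hR₁]
    exact B8.apriori_162 hB₀ hdL hα₀.le hα₁ h61
  refine ⟨?_, ?_, ?_, ?_⟩ <;> linarith [ha, hg', hj, hl, hR, h162]

/-! ## §3 The allowances absorbed: the same constant `5dLB₀(α₀ + α₁)` -/

/-- **(1.62) WITH THE PRINTED CONSTANT `5dLB₀(α₀ + α₁)` FOR THE FIRST TWO MEMBERS, THE BOUNDARY ALLOWANCES ABSORBED IN THE SLACK OF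
(1.60) ⇒ (1.62)**: `prop3_norms_kLevel_bdry` + `apriori_162_bdry` under `βa + βg ≤ (dL − 1)B₀(α₀ + α₁)` and `2βg ≤ (dL − 1)B₀(α₀ + α₁)`.
So the Theorem-4 induction invariant `|A| ≤ 5dLB₀(α₀ + α₁)(Lʲη)⁻¹` survives the repaired (1.59) currency when the exterior-collar term
fits that window (`4B_∂α₁ ≤ (dL − 1)B₀(α₀ + α₁)` at the consumer). [cite: Balaban1985RegularSpaces, Prop. 3 (1.62) p.87; (1.60)–(1.61) pp.86–87] -/
theorem prop3_norms_kLevel_bdry_absorbed (hd2 : 2 ≤ d) {η : ℝ} (hη : 0 < η) {L : ℕ} (hL : 2 ≤ L) {k : ℕ}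
    {U₀ : Site d → Fin d → 𝔸ˣ} (hU₀ : ∀ y κ, U₀ y κ ∈ unitaryUnits 𝔸)
    {A : Site d → Fin d → 𝔸} (hAh : ∀ y κ, IsSelfAdjoint (A y κ)) {α₀ α₁ α₂ g : ℝ}
    (hα₀ : 0 < α₀) (hα₁ : 0 ≤ α₁) (hα₂ : 0 ≤ α₂) (hg0 : 0 ≤ g)
    (hα3 : C0 d * α₀ ≤ 1 / 3) (hα4 : 4 * α₀ ≤ c2' d L) (h16 : 16 * α₂ ≤ 1) (hd5 : 5 * α₂ * ((d : ℝ) - 1) ≤ 4)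
    (hsmall : Real.exp (4 * (800 * ((d : ℝ) + 1) ^ 2 * ((d : ℝ) + 4)) * α₀)
      * (1 + 8 * (131072 * ((d : ℝ) + 1) ^ 2) * α₂) ≤ 2)
    (hc₃ : 2 * α₂ ≤ c3 d L) {B₀ : ℝ} (hB₀ : 0 ≤ B₀) (hside : 36 * d * B₀ * α₂ ≤ 1 / 2) (h50 : 50 * d * α₂ ≤ 1)
    {C₂ : ℝ} (hC₂ : 8 * (131072 * ((d : ℝ) + 1) ^ 2) * Real.exp (4 * (800 * ((d : ℝ) + 1) ^ 2 * ((d : ℝ) + 4)) * α₀) ≤ C₂)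
    (h61 : 2 * α₂ ^ 2 + 20 * d * α₀ * α₂ + 2 * C₂ * α₂ ^ 2 ≤ α₀ + α₁)
    {Ω : ℕ → Set (Site d)} {Λ : ℕ → Set (Site d × Fin d)}
    (hbox : ∀ j, j ≤ k → ∀ c ∈ Λ j, ∀ x, InBox (loK L j c.1) (bondHiK L j c.1 c.2) x → x ∈ Ω j)
    (h40₀ : InAk L k η α₀ Ω U₀) (h40₁ : InAk L k η α₀ Ω (mulCfg (expCfg (iEta η A)) U₀))
    (h41 : ∀ j, j ≤ k → ∀ y τ, SideTouches (Ω j) y τ → ‖A y τ‖ ≤ α₂ * ((L : ℝ) ^ j * η)⁻¹)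
    (hg : ∀ j, j ≤ k → ∀ (y : Site d) (κ τ : Fin d), SideTouches (Ω j) y τ →
      ((L : ℝ) ^ j * η) ^ 2 * ‖covDerivFwd η U₀ κ (fun z => A z τ) y‖ ≤ g)
    (h42 : ∀ j, j ≤ k → ∀ c ∈ Λ j, ‖logCovIter L U₀ (iEta η A) j c.1 c.2‖ < 2 * d * L * α₁)
    {a βa βg : ℝ} (hβ : βa + βg ≤ ((d : ℝ) * L - 1) * B₀ * (α₀ + α₁)) (hβg : 2 * βg ≤ ((d : ℝ) * L - 1) * B₀ * (α₀ + α₁))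
    (h59a : a ≤ B₀ * (bondNorm L k η (-(3 : ℝ)) Ω (fun x μ => Jcur η U₀ A μ x)
      + wsup 1 (fun p : {p : ℕ × (Site d × Fin d) // p.1 ≤ k ∧ p.2 ∈ Λ p.1} =>
          linCovIter L U₀ (iEta η A) p.1.1 p.1.2.1 p.1.2.2)) + βa)
    (h59g : g ≤ B₀ * (bondNorm L k η (-(3 : ℝ)) Ω (fun x μ => Jcur η U₀ A μ x)
      + wsup 1 (fun p : {p : ℕ × (Site d × Fin d) // p.1 ≤ k ∧ p.2 ∈ Λ p.1} =>
          linCovIter L U₀ (iEta η A) p.1.1 p.1.2.1 p.1.2.2)) + βg) :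
    a ≤ 5 * d * L * B₀ * (α₀ + α₁) ∧ g ≤ 5 * d * L * B₀ * (α₀ + α₁) := by
  have hL1 : 1 ≤ L := le_trans (by norm_num) hL
  have h₀ : ∀ y κ, U₀ y κ ∈ U1 𝔸 := fun y κ => unitaryUnits_le_U1 (hU₀ y κ)
  have h55 := eq155_norm_kLevel_hermitian hη hL1 h₀ hAh hα₀.le hα₂ h16 hd5 hg0 h40₀ h40₁ h41 hg
  have h41' : ∀ j, j ≤ k → ∀ x μ, BondTouches (Ω j) x μ → ‖A x μ‖ ≤ α₂ * ((L : ℝ) ^ j * η)⁻¹ :=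
    fun j hj x μ hb => bound_of_sideTouches hd2 (h41 j hj) x μ hb
  have h56 := wsup_B1_le_kLevel hη L hL (avgClosed_unitaryUnits d L) U₀ hU₀ hα₀ hα3 hα4 A hα₂ hsmall hc₃ hbox h40₀
    h41' hα₁ h42
  obtain ⟨ha, hg', -, -⟩ := apriori_160_bdry (Nat.cast_nonneg d) hB₀ hα₂ hg0 h55 h56 h59a h59g h59a h59a hside h50
  set R₀ := B₀ * (4 * α₀ + 4 * d * L * α₁ + 2 * α₂ ^ 2 + 20 * d * α₀ * α₂
      + 2 * (8 * (131072 * ((d : ℝ) + 1) ^ 2) * Real.exp (4 * (800 * ((d : ℝ) + 1) ^ 2 * ((d : ℝ) + 4)) * α₀))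
        * α₂ ^ 2) with hR₀
  set R₁ := B₀ * (4 * α₀ + 4 * d * L * α₁ + 2 * α₂ ^ 2 + 20 * d * α₀ * α₂ + 2 * C₂ * α₂ ^ 2) with hR₁
  have hR : R₀ ≤ R₁ := by
    rw [hR₀, hR₁]
    apply mul_le_mul_of_nonneg_left _ hB₀
    have hsq : 0 ≤ α₂ ^ 2 := sq_nonneg _
    nlinarith [mul_le_mul_of_nonneg_right hC₂ hsq]
  have hd' : (1 : ℝ) ≤ d := by exact_mod_cast (le_trans (by norm_num) hd2)
  have hdL : (1 : ℝ) ≤ (d : ℝ) * L := by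
    have hL' : (1 : ℝ) ≤ L := by exact_mod_cast hL1
    nlinarith
  have h162a : R₁ + (βa + βg) ≤ 5 * d * L * B₀ * (α₀ + α₁) := by
    rw [hR₁]; exact apriori_162_bdry hB₀ hdL hα₀.le h61 hβ
  have h162g : R₁ + 2 * βg ≤ 5 * d * L * B₀ * (α₀ + α₁) := by
    rw [hR₁]; exact apriori_162_bdry hB₀ hdL hα₀.le h61 hβg
  exact ⟨by linarith [ha, hR, h162a], by linarith [hg', hR, h162g]⟩

#print axioms apriori_160_bdry
#print axioms apriori_162_bdry
#print axioms prop3_norms_kLevel_bdry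
#print axioms prop3_norms_kLevel_bdry_absorbed

end Literature.MathematicalPhysics.QuantumFieldTheory.Balaban1983to89.B8Prop3KLevelBdry

end
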